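import Summits.CriticalPhenomena.PercolationContinuityZ3.Theorems.PercNearOneGluingNoHeavyQuantLawDEC
import HarnessLib

/-!
# QUANT lane R8, T-DEC: DEC with an EXPLICIT TARGET (`DECAtT`) — the bookkeeping object of every closure proof (pieces are decomposed at the
# target of the whole law, not at their own mean): definition, `DECAt ↔ DECAtT (mean)`, antitonicity in the target, mixtures at a common target

builds on p205010 (kernel theorem, internal audit signed; external expert review pending)

Statement + support file (`--supports stmt-CriticalPhenomena-4575`), QUANT lane seat prim-quant-census-2 (gen 53), rung R8 of
`run/shared/lean/prim/quant/LADDER.md`.  Memo `…/prim-quant-census-2-g53/DEC-CLOSURE-G53.md` §3.2 / §4 (TO TYPE (a)).  One definition, theorems with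
standard axioms.

* `LawDec.DECAtT x T j′ M μ` — `μ` on `{0..M}` is an exact finite mixture of two-point components valid at floor `x`, TARGET `T`, layer `j′` (same body as
  `LawDec.DECAt` with the mean replaced by the parameter `T`).
* `LawDec.decAt_iff_decAtT` — `DECAt x j′ M μ ↔ DECAtT x (Σ_{h ≤ M} h·μ h) j′ M μ`.
* `LawDec.validAt_antitone_target` / `decAtT_antitone_target` — a smaller target is easier (`T′ ≤ T`).
* `LawDec.decAtT_mixture` — two laws DEC at the SAME `(x, T, j′, M)` ⟹ every mixture `p·μ₁ + (1−p)·μ₂` (`0 ≤ p ≤ 1`) is (index `ρ₁ ⊕ ρ₂`).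
Use (memo §3.2): the slice / convolution pieces `TP_C ⊗ blob` must be shown `DECAtT x T j′` at the target `T` of the WHOLE law; S-, G- and heavy-N-pieces are
(criterion E inside the piece; BLOB-DEC(2) shifted), and `decAtT_mixture` reassembles them.

[this work]; DEC rules ARCH-TREES-G49 §2.2 / DEC-TAMP-G50 §3.1 (this lane).  The gluing rows served [cite: KozmaNitzan2024, Conjecture 3 (p. 15)];
product measure [cite: Grimmett1999, §1.3 p. 10].
-/

noncomputable section

namespace Summit.CriticalPhenomena.PercolationContinuityZ3.Theorems

namespace Quant

open Finset

/-- the two-point law `{lo, hi; g}` (as in `…QuantLawDEC`) -/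
local notation3 "TP[" lo ", " hi ", " g ", " h "]" =>
  (g : ℝ) * (if (h : ℕ) = (hi : ℕ) then (1 : ℝ) else 0) + (1 - (g : ℝ)) * (if (h : ℕ) = (lo : ℕ) then (1 : ℝ) else 0)

namespace LawDec

/-- **DEC(j′) at an explicit target `T`**: the law `μ` on `{0..M}` is an exact finite mixture of two-point components `{lo, hi; g}` each valid at
`(x, T, j′)` (`LawDec.ValidAt`).  `LawDec.DECAt` is the case `T = mean of μ` (`decAt_iff_decAtT`). [this work] -/
def DECAtT (x T : ℝ) (j' M : ℕ) (μ : ℕ → ℝ) : Prop :=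
  ∃ (ρ : Type) (_ : Fintype ρ) (lam g : ρ → ℝ) (lo hi : ρ → ℕ),
    (∀ r, 0 ≤ lam r) ∧ (∑ r, lam r = 1) ∧ (∀ r, 0 ≤ g r ∧ g r ≤ 1) ∧ (∀ r, lo r ≤ hi r) ∧ (∀ r, hi r ≤ M) ∧
    (∀ h, μ h = ∑ r, lam r * TP[lo r, hi r, g r, h]) ∧
    (∀ r, 0 < lam r → ValidAt x T j' (lo r) (hi r) (g r))

/-- `DECAt` is `DECAtT` at the law's own mean. [this work] -/
theorem decAt_iff_decAtT (x : ℝ) (j' M : ℕ) (μ : ℕ → ℝ) :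
    DECAt x j' M μ ↔ DECAtT x (∑ h ∈ Finset.range (M + 1), (h : ℝ) * μ h) j' M μ :=
  Iff.rfl

/-- **validity is antitone in the target.** [this work] -/
theorem validAt_antitone_target {x T T' : ℝ} {j' lo hi : ℕ} {g : ℝ} (hTT : T' ≤ T) (h : ValidAt x T j' lo hi g) :
    ValidAt x T' j' lo hi g := by
  rcases h with ⟨heq, hS⟩ | hG | ⟨hlt, hhi, hcr⟩
  · refine Or.inl ⟨heq, ?_⟩
    rcases hS with h2 | h2
    · exact Or.inl (hTT.trans h2)
    · exact Or.inr h2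
  · exact Or.inr (Or.inl hG)
  · exact Or.inr (Or.inr ⟨hlt, hhi, hTT.trans hcr⟩)

/-- **DEC at an explicit target is antitone in the target** (same decomposition). [this work] -/
theorem decAtT_antitone_target {x T T' : ℝ} {j' M : ℕ} {μ : ℕ → ℝ} (hTT : T' ≤ T) (h : DECAtT x T j' M μ) : DECAtT x T' j' M μ := by
  obtain ⟨ρ, hρ, lam, g, lo, hi, h0, h1, hg, hlohi, hhi, hμ, hval⟩ := h
  exact ⟨ρ, hρ, lam, g, lo, hi, h0, h1, hg, hlohi, hhi, hμ, fun r hr => validAt_antitone_target hTT (hval r hr)⟩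

/-- **Mixtures at a common target**: if `μ₁` and `μ₂` are DEC at the same `(x, T, j′, M)` then so is `p·μ₁ + (1−p)·μ₂` for `0 ≤ p ≤ 1`. [this work] -/
theorem decAtT_mixture {x T : ℝ} {j' M : ℕ} {μ₁ μ₂ : ℕ → ℝ} (p : ℝ) (hp0 : 0 ≤ p) (hp1 : p ≤ 1)
    (h₁ : DECAtT x T j' M μ₁) (h₂ : DECAtT x T j' M μ₂) :
    DECAtT x T j' M (fun h => p * μ₁ h + (1 - p) * μ₂ h) := by
  classical
  obtain ⟨ρ₁, hρ₁, lam₁, g₁, lo₁, hi₁, a0, a1, ag, alohi, ahi, aμ, aval⟩ := h₁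
  obtain ⟨ρ₂, hρ₂, lam₂, g₂, lo₂, hi₂, b0, b1, bg, blohi, bhi, bμ, bval⟩ := h₂
  refine ⟨ρ₁ ⊕ ρ₂, inferInstance, Sum.elim (fun r => p * lam₁ r) (fun r => (1 - p) * lam₂ r), Sum.elim g₁ g₂, Sum.elim lo₁ lo₂,
    Sum.elim hi₁ hi₂, ?_, ?_, ?_, ?_, ?_, fun h => ?_, ?_⟩
  · rintro (r | r)
    · exact mul_nonneg hp0 (a0 r)
    · exact mul_nonneg (by linarith) (b0 r)
  · rw [Fintype.sum_sum_type]
    simp only [Sum.elim_inl, Sum.elim_inr]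
    rw [← Finset.mul_sum, ← Finset.mul_sum, a1, b1]
    ring
  · rintro (r | r)
    · exact ag r
    · exact bg r
  · rintro (r | r)
    · exact alohi r
    · exact blohi r
  · rintro (r | r)
    · exact ahi r
    · exact bhi r
  · rw [Fintype.sum_sum_type]
    simp only [Sum.elim_inl, Sum.elim_inr]
    rw [aμ h, bμ h, Finset.mul_sum, Finset.mul_sum]
    congr 1 <;> refine Finset.sum_congr rfl fun r _ => ?_ <;> ring
  · rintro (r | r) hr
    · simp only [Sum.elim_inl] at hr ⊢
      exact aval r (pos_of_mul_pos_right hr hp0)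
    · simp only [Sum.elim_inr] at hr ⊢
      exact bval r (pos_of_mul_pos_right hr (by linarith))

end LawDec

end Quant

end Summit.CriticalPhenomena.PercolationContinuityZ3.Theorems
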